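import Summits.CriticalPhenomena.PercolationContinuityZ3.Theorems.PercNearOneGluingNoHeavyLowerTailKnQuestion8CoefficientwiseTopStratum
import HarnessLib

/-!
# The root-set kernel: the top row of RCSET is a theorem — prim-lf-2 gen 58

Support file (`--supports stmt-CriticalPhenomena-4575`, closed), prover `prim-lf-2` (gen 58).  No definitions, no named facts, no sorries; standard axioms.
Memo `prim-lf-2/CW-IGCEX-gen58.md` §8b–§8d.

THE ROOT-SET KERNEL.  For a multigraph `ends : ι → Sym2 V`, edge set `E`, target `y` and root sets `A, B` (finsets of vertices) put, for a colouring `s ⊆ E` (red) / `E ∖ s` (blue),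
`R_A(s) = {v | ∃ a ∈ A, v ∈ C_a(s)}` (red cluster of the SET `A`), `B_B(s) = {v | ∃ b ∈ B, v ∈ C_b(E ∖ s)}` (blue cluster of `B`), and
  `Φ(A, B) := Σ_{s ⊆ E : ¬(y ∈ R_A(s) ∧ y ∈ B_B(s))} (f R_A(s) − f B_B(s))·(g R_A(s) − g B_B(s))`.
`Φ(S,S)` is the NO-CORE sum of `G/S`; for a root edge `e = xp`, `NC(G) = 2Φ_{G−e}({x},{x,p})` and `NC(G/e) = Φ_{G−e}({x,p},{x,p})`, so the root-contraction inequality RC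
(`…CoefficientwiseContraction.lean`, hypothesis of `noCore_of_rootContraction`) is the case `(S, S') = ({x},{x,p})` of
  CONJECTURE RCSET (prim-lf-2 gen 58):  `2·Φ(S, S') ≥ Φ(S', S')` for all nested root sets `S ⊆ S'`, `y ∉ S'`
(census: every graph on ≤ 6 vertices, every `y`, every nested pair, point/pair functions: 0 / 1.3·10⁹ violations).
* `Coefficientwise.rcset_top_row` — **THEOREM: the top row `S' = V ∖ {y}` of RCSET.**  For finite `V`, monotone `f, g`, every `S` with `y ∉ S`:
  `Φ(V∖y, V∖y) ≤ 2·Φ(S, V∖y)`.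
Proof.  Let `St` be the non-loop edges of `E` at `y`, `W = V ∖ y`, `δf = f(V) − f(W) ≥ 0`.  Colourings with both a red and a blue edge in `St` contribute `0` to `Φ(W,W)` (then
`y ∈ R_W ∩ B_W`) and `≥ 0` to `Φ(S,W)` (then `B_W = V ⊇ R_S`).  Pair the colouring `t` with no red edge at `y` with `t ∪ St`: they contribute `δf·δg` each to `Φ(W,W)`
(`R_W = W, B_W = V` resp. `R_W = V, B_W = W`), and `F·G + u·v` to `Φ(S,W)` with `F = f(V) − f(R_S(t)) ≥ δf`, `G ≥ δg`, `u = f(R_S(t ∪ St)) − f(W) ∈ [δf − F, δf]`,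
`v ∈ [δg − G, δg]` (`R_S(t) ⊆ W`, `R_S(t) ⊆ R_S(t ∪ St) ⊆ V`); elementary: `F·G + u·v ≥ δf·δg`.
[cite: KozmaNitzan2024, Questions 8–9 (§5.5 p. 36) (context: the Question-8 pocket covariance programme)]
-/

namespace Summit.CriticalPhenomena.PercolationContinuityZ3.Theorems

open Finset Literature.Probability.Percolation

namespace Coefficientwise

variable {ι V : Type*} [DecidableEq ι]

/-- Elementary: `F ≥ δf ≥ 0`, `G ≥ δg ≥ 0`, `δf − F ≤ u ≤ δf`, `δg − G ≤ v ≤ δg` imply `δf·δg ≤ F·G + u·v`. [folklore] -/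
theorem box_product_bound {F G u v δf δg : ℝ} (hδf : 0 ≤ δf) (hδg : 0 ≤ δg) (hF : δf ≤ F) (hG : δg ≤ G)
    (hu1 : δf - F ≤ u) (hu2 : u ≤ δf) (hv1 : δg - G ≤ v) (hv2 : v ≤ δg) : δf * δg ≤ F * G + u * v := by
  rcases le_or_gt 0 u with hu | hu <;> rcases le_or_gt 0 v with hv | hv
  · nlinarith [mul_nonneg hu hv, mul_le_mul hF hG hδg (le_trans hδf hF)]
  · -- `u ≥ 0 > v`: `u·v ≥ δf·v ≥ δf·(δg − G)`
    have h1 : δf * (δg - G) ≤ u * v := by nlinarith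
    nlinarith [mul_nonneg hδf (sub_nonneg.mpr hG), mul_nonneg (sub_nonneg.mpr hF) (le_trans hδg hG)]
  · have h1 : (δf - F) * δg ≤ u * v := by nlinarith
    nlinarith [mul_nonneg (sub_nonneg.mpr hF) hδg, mul_nonneg (le_trans hδf hF) (sub_nonneg.mpr hG)]
  · nlinarith [mul_pos_of_neg_of_neg hu hv, mul_le_mul hF hG hδg (le_trans hδf hF)]

open Classical in
/-- **The top row of RCSET** (see the module docstring): for finite `V`, monotone `f, g` and `y ∉ S`,
`Φ(V∖y, V∖y) ≤ 2·Φ(S, V∖y)` for the root-set kernel `Φ` of `(ends, E, y, f, g)`. [cite: KozmaNitzan2024, Questions 8–9 (§5.5 p. 36) (context)] -/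
theorem rcset_top_row [Fintype V] [DecidableEq V] (ends : ι → Sym2 V) (E : Finset ι) (y : V) (S : Finset V) (hyS : y ∉ S)
    (f g : Set V → ℝ) (hf : Monotone f) (hg : Monotone g) :
    (∑ s ∈ E.powerset.filter (fun s : Finset ι =>
          ¬ ((∃ a ∈ (Finset.univ : Finset V).erase y, y ∈ openCluster (ends '' (↑s : Set ι)) a) ∧
             (∃ a ∈ (Finset.univ : Finset V).erase y, y ∈ openCluster (ends '' (↑(E \ s) : Set ι)) a))),
        (f {v | ∃ a ∈ (Finset.univ : Finset V).erase y, v ∈ openCluster (ends '' (↑s : Set ι)) a} -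
            f {v | ∃ a ∈ (Finset.univ : Finset V).erase y, v ∈ openCluster (ends '' (↑(E \ s) : Set ι)) a}) *
          (g {v | ∃ a ∈ (Finset.univ : Finset V).erase y, v ∈ openCluster (ends '' (↑s : Set ι)) a} -
            g {v | ∃ a ∈ (Finset.univ : Finset V).erase y, v ∈ openCluster (ends '' (↑(E \ s) : Set ι)) a})) ≤
    2 * ∑ s ∈ E.powerset.filter (fun s : Finset ι =>
          ¬ ((∃ a ∈ S, y ∈ openCluster (ends '' (↑s : Set ι)) a) ∧
             (∃ a ∈ (Finset.univ : Finset V).erase y, y ∈ openCluster (ends '' (↑(E \ s) : Set ι)) a))),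
        (f {v | ∃ a ∈ S, v ∈ openCluster (ends '' (↑s : Set ι)) a} -
            f {v | ∃ a ∈ (Finset.univ : Finset V).erase y, v ∈ openCluster (ends '' (↑(E \ s) : Set ι)) a}) *
          (g {v | ∃ a ∈ S, v ∈ openCluster (ends '' (↑s : Set ι)) a} -
            g {v | ∃ a ∈ (Finset.univ : Finset V).erase y, v ∈ openCluster (ends '' (↑(E \ s) : Set ι)) a}) := by
  -- notation
  set W : Finset V := (Finset.univ : Finset V).erase y with hW
  set RW : Finset ι → Set V := fun t => {v | ∃ a ∈ W, v ∈ openCluster (ends '' (↑t : Set ι)) a} with hRW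
  set RS : Finset ι → Set V := fun t => {v | ∃ a ∈ S, v ∈ openCluster (ends '' (↑t : Set ι)) a} with hRS
  set admW : Finset ι → Prop := fun s => ¬ ((∃ a ∈ W, y ∈ openCluster (ends '' (↑s : Set ι)) a) ∧
      (∃ a ∈ W, y ∈ openCluster (ends '' (↑(E \ s) : Set ι)) a)) with hadmW
  set admS : Finset ι → Prop := fun s => ¬ ((∃ a ∈ S, y ∈ openCluster (ends '' (↑s : Set ι)) a) ∧
      (∃ a ∈ W, y ∈ openCluster (ends '' (↑(E \ s) : Set ι)) a)) with hadmS
  set TW : Finset ι → ℝ := fun s => (f (RW s) - f (RW (E \ s))) * (g (RW s) - g (RW (E \ s))) with hTW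
  set TS : Finset ι → ℝ := fun s => (f (RS s) - f (RW (E \ s))) * (g (RS s) - g (RW (E \ s))) with hTS
  change ∑ s ∈ E.powerset.filter admW, TW s ≤ 2 * ∑ s ∈ E.powerset.filter admS, TS s
  -- the star of `y`
  set St : Finset ι := E.filter (fun i => ∃ w : V, w ≠ y ∧ ends i = s(w, y)) with hSt
  have hStE : St ⊆ E := Finset.filter_subset _ E
  -- (1) `y` red-reached from a set not containing `y` forces a red non-loop edge at `y`
  have reach_star : ∀ (A : Finset V) (t : Finset ι), y ∉ A → t ⊆ E → (∃ a ∈ A, y ∈ openCluster (ends '' (↑t : Set ι)) a) → (t ∩ St).Nonempty := by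
    intro A t hyA ht ⟨a, ha, hay⟩
    have hay' : y ≠ a := fun h => hyA (h ▸ ha)
    obtain ⟨i, hi, w, hwy, hiw⟩ := exists_properEdge_of_mem_openCluster ends hay hay'
    exact ⟨i, Finset.mem_inter.mpr ⟨hi, Finset.mem_filter.mpr ⟨ht hi, w, hwy, hiw⟩⟩⟩
  -- (2) a non-loop edge at `y` in `t` puts `y` in `R_W(t)`
  have star_reach : ∀ t : Finset ι, (t ∩ St).Nonempty → ∃ a ∈ W, y ∈ openCluster (ends '' (↑t : Set ι)) a := by
    rintro t ⟨i, hi⟩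
    obtain ⟨hit, hiSt⟩ := Finset.mem_inter.mp hi
    obtain ⟨_, w, hwy, hiw⟩ := Finset.mem_filter.mp hiSt
    refine ⟨w, Finset.mem_erase.mpr ⟨hwy, Finset.mem_univ w⟩, ?_⟩
    have hadj : (openGraph (ends '' (↑t : Set ι))).Adj w y := by
      rw [openGraph_image_adj]; exact ⟨⟨i, hit, hiw⟩, hwy⟩
    exact hadj.reachable
  have hyW : y ∉ W := fun h => (Finset.mem_erase.mp h).1 rfl
  -- (3) set identities
  have W_sub_RW : ∀ t : Finset ι, (↑W : Set V) ⊆ RW t := fun t v hv => ⟨v, hv, mem_openCluster_self _ v⟩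
  have RW_eq_W : ∀ t : Finset ι, t ⊆ E → t ∩ St = ∅ → RW t = (↑W : Set V) := by
    intro t ht h0
    refine Set.Subset.antisymm (fun v hv => ?_) (W_sub_RW t)
    by_cases hvy : v = y
    · subst hvy
      exact absurd (reach_star W t hyW ht hv) (Finset.not_nonempty_iff_eq_empty.mpr h0)
    · exact Finset.mem_coe.mpr (Finset.mem_erase.mpr ⟨hvy, Finset.mem_univ v⟩)
  have RW_eq_univ : ∀ t : Finset ι, (t ∩ St).Nonempty → RW t = Set.univ := by
    intro t hne
    refine Set.eq_univ_of_forall fun v => ?_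
    by_cases hvy : v = y
    · subst hvy; exact star_reach t hne
    · exact W_sub_RW t (Finset.mem_coe.mpr (Finset.mem_erase.mpr ⟨hvy, Finset.mem_univ v⟩))
  have RS_sub_W : ∀ t : Finset ι, t ⊆ E → t ∩ St = ∅ → RS t ⊆ (↑W : Set V) := by
    intro t ht h0 v hv
    by_cases hvy : v = y
    · subst hvy
      exact absurd (reach_star S t hyS ht hv) (Finset.not_nonempty_iff_eq_empty.mpr h0)
    · exact Finset.mem_coe.mpr (Finset.mem_erase.mpr ⟨hvy, Finset.mem_univ v⟩)
  have RS_mono : ∀ {t t' : Finset ι}, t ⊆ t' → RS t ⊆ RS t' := by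
    intro t t' htt' v ⟨a, ha, hva⟩
    exact ⟨a, ha, openCluster_image_mono ends htt' a hva⟩
  have RS_sub_univ : ∀ t : Finset ι, RS t ⊆ Set.univ := fun t => Set.subset_univ _
  -- complements: for `t ⊆ E ∖ St`, `E ∖ t ⊇ St` and `E ∖ (t ∪ St)` misses `St`
  set E' : Finset ι := E \ St with hE'
  have sdiff_inter : ∀ t : Finset ι, t ⊆ E' → St.Nonempty → ((E \ t) ∩ St).Nonempty := by
    intro t ht ⟨i, hi⟩
    refine ⟨i, Finset.mem_inter.mpr ⟨Finset.mem_sdiff.mpr ⟨hStE hi, fun hit => ?_⟩, hi⟩⟩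
    have := Finset.mem_sdiff.mp (ht hit); exact this.2 hi
  have sdiff_union_inter : ∀ t : Finset ι, (E \ (t ∪ St)) ∩ St = ∅ := by
    intro t; ext i; simp only [Finset.mem_inter, Finset.mem_sdiff, Finset.mem_union, Finset.notMem_empty, iff_false, not_and]
    intro h hi; exact h.2 (Or.inr hi)
  have t_inter : ∀ t : Finset ι, t ⊆ E' → t ∩ St = ∅ := by
    intro t ht; ext i; simp only [Finset.mem_inter, Finset.notMem_empty, iff_false, not_and]
    intro hit hiSt; have := Finset.mem_sdiff.mp (ht hit); exact this.2 hiSt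
  have tSt_inter : ∀ t : Finset ι, St.Nonempty → ((t ∪ St) ∩ St).Nonempty := by
    rintro t ⟨i, hi⟩; exact ⟨i, Finset.mem_inter.mpr ⟨Finset.mem_union_right _ hi, hi⟩⟩
  have tSt_sub : ∀ t : Finset ι, t ⊆ E' → t ∪ St ⊆ E := fun t ht =>
    Finset.union_subset (fun i hi => (Finset.mem_sdiff.mp (ht hi)).1) hStE
  have t_sub : ∀ t : Finset ι, t ⊆ E' → t ⊆ E := fun t ht i hi => (Finset.mem_sdiff.mp (ht hi)).1
  -- the trivial case: no proper edge at `y`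
  by_cases hSt0 : St = ∅
  · -- then `Φ(W,W) = 0` termwise and `Φ(S,W) ≥ 0` termwise
    have hL : ∑ s ∈ E.powerset.filter admW, TW s = 0 := by
      refine Finset.sum_eq_zero fun s hs => ?_
      have hsE := Finset.mem_powerset.mp (Finset.mem_filter.mp hs).1
      have h1 : RW s = ↑W := RW_eq_W s hsE (by rw [hSt0, Finset.inter_empty])
      have h2 : RW (E \ s) = ↑W := RW_eq_W (E \ s) Finset.sdiff_subset (by rw [hSt0, Finset.inter_empty])
      simp only [hTW, h1, h2, sub_self, mul_zero]
    have hR : 0 ≤ ∑ s ∈ E.powerset.filter admS, TS s := by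
      refine Finset.sum_nonneg fun s hs => ?_
      have hsE := Finset.mem_powerset.mp (Finset.mem_filter.mp hs).1
      have h2 : RW (E \ s) = ↑W := RW_eq_W (E \ s) Finset.sdiff_subset (by rw [hSt0, Finset.inter_empty])
      have h1 : RS s ⊆ ↑W := RS_sub_W s hsE (by rw [hSt0, Finset.inter_empty])
      simp only [hTS, h2]
      exact mul_nonneg_of_nonpos_of_nonpos (sub_nonpos.mpr (hf h1)) (sub_nonpos.mpr (hg h1))
    rw [hL]; linarith
  have hStne : St.Nonempty := Finset.nonempty_of_ne_empty hSt0
  -- constants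
  set δf : ℝ := f Set.univ - f ↑W with hδf
  set δg : ℝ := g Set.univ - g ↑W with hδg
  have hδf0 : 0 ≤ δf := sub_nonneg.mpr (hf (Set.subset_univ _))
  have hδg0 : 0 ≤ δg := sub_nonneg.mpr (hg (Set.subset_univ _))
  -- LHS: split `E.powerset` into `{s : s ∩ St = ∅}`, `{s : St ⊆ s}` and the mixed ones (which contribute 0)
  have class_iff : ∀ s : Finset ι, s ⊆ E → (admW s ↔ (s ∩ St = ∅ ∨ (E \ s) ∩ St = ∅)) := by
    intro s hs
    simp only [hadmW, not_and_or]
    constructor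
    · rintro (h | h)
      · left; by_contra hne; exact h (star_reach s (Finset.nonempty_of_ne_empty hne))
      · right; by_contra hne; exact h (star_reach (E \ s) (Finset.nonempty_of_ne_empty hne))
    · rintro (h | h)
      · left; exact fun hr => (Finset.not_nonempty_iff_eq_empty.mpr h) (reach_star W s hyW hs hr)
      · right; exact fun hr => (Finset.not_nonempty_iff_eq_empty.mpr h) (reach_star W (E \ s) hyW Finset.sdiff_subset hr)
  -- reindexing maps
  have blue_set : E.powerset.filter (fun s => s ∩ St = ∅) = E'.powerset := by
    ext t
    simp only [Finset.mem_filter, Finset.mem_powerset, hE', Finset.subset_sdiff]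
    constructor
    · rintro ⟨htE, ht⟩; exact ⟨htE, Finset.disjoint_iff_inter_eq_empty.mpr ht⟩
    · rintro ⟨htE, ht⟩; exact ⟨htE, Finset.disjoint_iff_inter_eq_empty.mp ht⟩
  have hfix : ∀ s ∈ E.powerset.filter (fun s => (E \ s) ∩ St = ∅), s \ St ∪ St = s := by
    intro s hs
    have h0 := (Finset.mem_filter.mp hs).2
    have hSts : St ⊆ s := by
      intro i hi
      by_contra his
      have : i ∈ (E \ s) ∩ St := Finset.mem_inter.mpr ⟨Finset.mem_sdiff.mpr ⟨hStE hi, his⟩, hi⟩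
      rw [h0] at this; exact Finset.notMem_empty i this
    exact Finset.sdiff_union_of_subset hSts
  have red_sum : ∀ φ : Finset ι → ℝ, ∑ s ∈ E.powerset.filter (fun s => (E \ s) ∩ St = ∅), φ s = ∑ t ∈ E'.powerset, φ (t ∪ St) := by
    intro φ
    refine Finset.sum_bij' (fun s _ => s \ St) (fun t _ => t ∪ St) ?_ ?_ ?_ ?_ ?_
    · intro s hs
      have hsE := Finset.mem_powerset.mp (Finset.mem_filter.mp hs).1
      exact Finset.mem_powerset.mpr (Finset.sdiff_subset_sdiff hsE le_rfl)
    · intro t ht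
      have htE' := Finset.mem_powerset.mp ht
      exact Finset.mem_filter.mpr ⟨Finset.mem_powerset.mpr (tSt_sub t htE'), sdiff_union_inter t⟩
    · intro s hs; exact hfix s hs
    · intro t ht
      have htE' := Finset.mem_powerset.mp ht
      rw [Finset.union_sdiff_right, Finset.sdiff_eq_self_iff_disjoint]
      exact Finset.disjoint_iff_inter_eq_empty.mpr (t_inter t htE')
    · intro s hs; rw [hfix s hs]
  -- generic three-way split of a filtered sum
  have split3 : ∀ (P : Finset ι → Prop) [DecidablePred P] (φ : Finset ι → ℝ),
      (∀ s, s ⊆ E → P s → (s ∩ St = ∅ ∨ (E \ s) ∩ St = ∅) ∨ 0 ≤ φ s) →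
      (∀ s, s ⊆ E → s ∩ St = ∅ → P s) → (∀ s, s ⊆ E → (E \ s) ∩ St = ∅ → P s) →
      ∑ t ∈ E'.powerset, (φ t + φ (t ∪ St)) ≤ ∑ s ∈ E.powerset.filter P, φ s ∧
      (( ∀ s, s ⊆ E → P s → (s ∩ St = ∅ ∨ (E \ s) ∩ St = ∅)) →
        ∑ s ∈ E.powerset.filter P, φ s = ∑ t ∈ E'.powerset, (φ t + φ (t ∪ St))) := by
    intro P _ φ hmix hblue hred
    -- write the filtered sum as a sum over the powerset of an indicator
    have hdisj : ∀ s, s ⊆ E → ¬ (s ∩ St = ∅ ∧ (E \ s) ∩ St = ∅) := by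
      intro s hsE ⟨h1, h2⟩
      obtain ⟨i, hi⟩ := hStne
      by_cases his : i ∈ s
      · have : i ∈ s ∩ St := Finset.mem_inter.mpr ⟨his, hi⟩
        rw [h1] at this; exact Finset.notMem_empty i this
      · have : i ∈ (E \ s) ∩ St := Finset.mem_inter.mpr ⟨Finset.mem_sdiff.mpr ⟨hStE hi, his⟩, hi⟩
        rw [h2] at this; exact Finset.notMem_empty i this
    have hsumB : ∑ s ∈ E.powerset.filter (fun s => s ∩ St = ∅), φ s = ∑ t ∈ E'.powerset, φ t := by rw [blue_set]
    have hsumR := red_sum φ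
    have key : ∑ s ∈ E.powerset.filter P, φ s =
        ∑ t ∈ E'.powerset, (φ t + φ (t ∪ St)) + ∑ s ∈ E.powerset.filter (fun s => P s ∧ ¬ (s ∩ St = ∅ ∨ (E \ s) ∩ St = ∅)), φ s := by
      rw [Finset.sum_add_distrib, ← hsumB, ← hsumR, Finset.sum_filter, Finset.sum_filter, Finset.sum_filter, Finset.sum_filter,
        ← Finset.sum_add_distrib, ← Finset.sum_add_distrib]
      refine Finset.sum_congr rfl fun s hs => ?_
      have hsE := Finset.mem_powerset.mp hs
      by_cases h1 : s ∩ St = ∅ <;> by_cases h2 : (E \ s) ∩ St = ∅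
      · exact absurd ⟨h1, h2⟩ (hdisj s hsE)
      · simp [h1, h2, hblue s hsE h1]
      · simp [h1, h2, hred s hsE h2]
      · by_cases hP : P s <;> simp [h1, h2, hP]
    constructor
    · rw [key]
      have : 0 ≤ ∑ s ∈ E.powerset.filter (fun s => P s ∧ ¬ (s ∩ St = ∅ ∨ (E \ s) ∩ St = ∅)), φ s := by
        refine Finset.sum_nonneg fun s hs => ?_
        obtain ⟨hs1, hP, hnot⟩ := by simpa only [Finset.mem_filter] using hs
        rcases hmix s (Finset.mem_powerset.mp hs1) hP with h | h
        · exact absurd h hnot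
        · exact h
      linarith
    · intro hall
      rw [key]
      have : ∑ s ∈ E.powerset.filter (fun s => P s ∧ ¬ (s ∩ St = ∅ ∨ (E \ s) ∩ St = ∅)), φ s = 0 := by
        refine Finset.sum_eq_zero fun s hs => ?_
        obtain ⟨hs1, hP, hnot⟩ := by simpa only [Finset.mem_filter] using hs
        exact absurd (hall s (Finset.mem_powerset.mp hs1) hP) hnot
      rw [this, add_zero]
  -- apply the split to both sides
  have hLeq : ∑ s ∈ E.powerset.filter admW, TW s = ∑ t ∈ E'.powerset, (TW t + TW (t ∪ St)) :=
    (split3 admW TW (fun s hs h => Or.inl ((class_iff s hs).mp h)) (fun s hs h => (class_iff s hs).mpr (Or.inl h))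
      (fun s hs h => (class_iff s hs).mpr (Or.inr h))).2 (fun s hs h => (class_iff s hs).mp h)
  have hRge : ∑ t ∈ E'.powerset, (TS t + TS (t ∪ St)) ≤ ∑ s ∈ E.powerset.filter admS, TS s := by
    refine (split3 admS TS ?_ ?_ ?_).1
    · -- mixed colourings: `B_W = V ⊇ R_S`, so the term is `≥ 0`
      intro s hs hP
      by_cases h2 : (E \ s) ∩ St = ∅
      · exact Or.inl (Or.inr h2)
      · right
        have hBW : RW (E \ s) = Set.univ := RW_eq_univ (E \ s) (Finset.nonempty_of_ne_empty h2)
        simp only [hTS, hBW]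
        exact mul_nonneg_of_nonpos_of_nonpos (sub_nonpos.mpr (hf (Set.subset_univ _))) (sub_nonpos.mpr (hg (Set.subset_univ _)))
    · intro s hs h0
      exact fun ⟨hr, _⟩ => (Finset.not_nonempty_iff_eq_empty.mpr h0) (reach_star S s hyS hs hr)
    · intro s hs h0
      exact fun ⟨_, hb⟩ => (Finset.not_nonempty_iff_eq_empty.mpr h0) (reach_star W (E \ s) hyW Finset.sdiff_subset hb)
  -- the termwise inequality for a colouring `t` with no edge of `St`
  have hterm : ∀ t ∈ E'.powerset, TW t + TW (t ∪ St) ≤ 2 * (TS t + TS (t ∪ St)) := by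
    intro t ht
    have htE' := Finset.mem_powerset.mp ht
    have ht0 : t ∩ St = ∅ := t_inter t htE'
    -- values of the W-clusters
    have hRWt : RW t = ↑W := RW_eq_W t (t_sub t htE') ht0
    have hRWct : RW (E \ t) = Set.univ := RW_eq_univ (E \ t) (sdiff_inter t htE' hStne)
    have hRWtS : RW (t ∪ St) = Set.univ := RW_eq_univ (t ∪ St) (tSt_inter t hStne)
    have hRWctS : RW (E \ (t ∪ St)) = ↑W := RW_eq_W (E \ (t ∪ St)) Finset.sdiff_subset (sdiff_union_inter t)
    -- bounds for the S-clusters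
    have hA : RS t ⊆ ↑W := RS_sub_W t (t_sub t htE') ht0
    have hAA' : RS t ⊆ RS (t ∪ St) := RS_mono Finset.subset_union_left
    have hLval : TW t + TW (t ∪ St) = 2 * (δf * δg) := by
      simp only [hTW, hRWt, hRWct, hRWtS, hRWctS, hδf, hδg]; ring
    rw [hLval]
    have hRval : TS t + TS (t ∪ St) = (f Set.univ - f (RS t)) * (g Set.univ - g (RS t)) +
        (f (RS (t ∪ St)) - f ↑W) * (g (RS (t ∪ St)) - g ↑W) := by
      simp only [hTS, hRWct, hRWctS]; ring
    rw [hRval]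
    have key := box_product_bound (F := f Set.univ - f (RS t)) (G := g Set.univ - g (RS t))
      (u := f (RS (t ∪ St)) - f ↑W) (v := g (RS (t ∪ St)) - g ↑W) hδf0 hδg0
      (by simp only [hδf]; linarith [hf hA]) (by simp only [hδg]; linarith [hg hA])
      (by simp only [hδf]; linarith [hf hAA']) (by simp only [hδf]; linarith [hf (RS_sub_univ (t ∪ St))])
      (by simp only [hδg]; linarith [hg hAA']) (by simp only [hδg]; linarith [hg (RS_sub_univ (t ∪ St))])
    linarith
  calc ∑ s ∈ E.powerset.filter admW, TW s = ∑ t ∈ E'.powerset, (TW t + TW (t ∪ St)) := hLeq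
    _ ≤ ∑ t ∈ E'.powerset, 2 * (TS t + TS (t ∪ St)) := Finset.sum_le_sum hterm
    _ = 2 * ∑ t ∈ E'.powerset, (TS t + TS (t ∪ St)) := by rw [Finset.mul_sum]
    _ ≤ 2 * ∑ s ∈ E.powerset.filter admS, TS s := by linarith [hRge]


end Coefficientwise

end Summit.CriticalPhenomena.PercolationContinuityZ3.Theorems
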